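import Literature.IUT.HodgeArakelov.AbsTopMonoidsGenuineZHatPow
import Literature.AnabelianGeometry.EtaleTheta.CyclotomeZHatSign
import HarnessLib

/-!
# [IUTchII] Rmk 1.11.1 (i) (b) / Ex 1.8 (iv) at the genuine producers: `−1 ∈ Ẑ^×` acts on `O^×(G) = 𝒪_k̄^×` by INVERSION
# (non-degeneracy of the natural `Ẑ^×`-action `x ↦ x^u`; proof-only sequel of `AbsTopMonoidsGenuineZHatPow`)

S. Mochizuki, *Inter-universal Teichmüller theory II*, §1, Remark 1.11.1 (i) (b) p. 50 («the natural action of `Ẑ^×`» on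
`O^×(G)`), Example 1.8 (iv) p. 39, kurims manuscript (Dec. 2020) [claim: Mochizuki2012, status: disputed]
(IUTchII §1 Rmk 1.11.1 (i), kurims p.50); [AbsTopIII] Prop. 3.3 (ii) p. 74 [MochizukiAbsTopIII2015]. abc-iut cell, layer L6,
seat abc-iut-w6-d010, row «RMK1111B-GENUINE», file D (NON-VACUITY of the def of file A, p431139). PROOF-ONLY.

* `Genuine.coe_zhatUnitAut_negOneAut` — THE `Gal(k̄/k)`-equivariant automorphism `x ↦ x^{−1}` of `𝒪_k̄^×` attached by
  file A to `−1 ∈ Ẑ^× = Aut(Ẑ)` (abc-iut L2's `ZHatLevel.negOneAut`, `levelChar_negOneAut`: `χ_m(−1) = −1`) IS inversion: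
  `(x^{−1} : k̄) = (x : k̄)⁻¹` (uniqueness `zhatUnitAut_unique` against the transported inversion of `(𝒪_k̄^⊳)ˣ`);
* `Genuine.zhatPowOunits_negOneAut` — on `O^×(G) = (𝒪_k̄^⊳)ˣ`: `zhatPowOunits C (−1) = (x ↦ x⁻¹)`; in particular the
  action is NOT trivial (`zhatPowOunits_negOneAut_ne_one`: `𝒪_k̄^×` has an element with `x ≠ x⁻¹`, e.g. a primitive cube
  root of unity) — the same `−1` that abc-iut-L6-d2 uses on `O^{×μ}(G)` (`actIsm_toIsm_negOneAut`), so that on classes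
  modulo torsion the two actions agree at `u = −1`.

HONEST FRAMING: classical; nothing here bears on [IUTchIII] Cor. 3.12 or takes a side.
-/

noncomputable section

namespace Literature.IUT.HodgeArakelov

open CategoryTheory
open Literature.AnabelianGeometry.AbsoluteAnabelian
open Literature.AnabelianGeometry.EtaleTheta

namespace AbsTopMonoids

namespace Genuine

variable (C : MLFClosure.{0})

/-- Underlying elements of `k̄`: the inverse of a unit of `𝒪_k̄^⊳` is its field inverse.
[cite: MochizukiAbsTopIII2015, Definition 3.1 (i) p.66] -/
theorem coe_inv_nonzeroIntegersUnits (z : (nonzeroIntegers C.k C.K)ˣ) :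
    (((z⁻¹ : (nonzeroIntegers C.k C.K)ˣ) : nonzeroIntegers C.k C.K) : C.K) =
      (((z : (nonzeroIntegers C.k C.K)ˣ) : nonzeroIntegers C.k C.K) : C.K)⁻¹ := by
  symm
  apply inv_eq_of_mul_eq_one_left
  rw [← Submonoid.coe_mul, ← Units.val_mul, inv_mul_cancel, Units.val_one, Submonoid.coe_one]

/-- **`x ↦ x^{−1}` on `𝒪_k̄^×` IS inversion**: for `−1 ∈ Ẑ^×` (`ZHatLevel.negOneAut`), the automorphism `zhatUnitAut C (−1)`
of file A acts on underlying elements of `k̄` by `x ↦ x⁻¹` — the transported inversion of `(𝒪_k̄^⊳)ˣ` is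
`Gal(k̄/k)`-equivariant and acts on `μ_m` by `ζ ↦ ζ^{χ_m(−1)} = ζ^{m−1} = ζ⁻¹`, so uniqueness applies.
[cite: MochizukiAbsTopIII2015, Proposition 3.3 (ii) p.74] -/
theorem coe_zhatUnitAut_negOneAut (x : unitSubmonoid C.k C.K) :
    ((zhatUnitAut C ZHatLevel.negOneAut x : unitSubmonoid C.k C.K) : C.K) = ((x : C.K))⁻¹ := by
  -- inversion of `(𝒪_k̄^⊳)ˣ` transported to `unitSubmonoid`
  let e := ModelMLFGaloisData.unitsEquivUnitSubmonoid C
  let β : unitSubmonoid C.k C.K ≃* unitSubmonoid C.k C.K := e.symm.trans ((MulEquiv.inv _).trans e)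
  have hβ : ∀ y : unitSubmonoid C.k C.K, ((β y : unitSubmonoid C.k C.K) : C.K) = ((y : C.K))⁻¹ := by
    intro y
    change ((e ((e.symm y)⁻¹) : unitSubmonoid C.k C.K) : C.K) = _
    rw [ModelMLFGaloisData.coe_unitsEquivUnitSubmonoid, coe_inv_nonzeroIntegersUnits,
      ← ModelMLFGaloisData.coe_unitsEquivUnitSubmonoid C (e.symm y), MulEquiv.apply_symm_apply]
  have hβeq : β = zhatUnitAut C ZHatLevel.negOneAut := by
    refine zhatUnitAut_unique C _ β (fun σ a b hab => ?_) fun a m hm ham => ?_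
    · rw [hβ, hβ, hab, map_inv₀]
    · rw [hβ, levelExp_of_pos _ hm, ZHatLevel.levelChar_negOneAut]
      have ha0 : (a : C.K) ≠ 0 := fun h => by
        rw [h, zero_pow hm.ne'] at ham
        exact zero_ne_one ham
      have hu : (Units.mk0 (a : C.K) ha0) ^ ((⟨m, hm⟩ : ℕ+) : ℕ) = 1 := Units.ext (by simpa using ham)
      have h := cyclotome.pow_val_neg_one_eq_inv hu
      have h' := congrArg (fun w : (C.K)ˣ => (w : C.K)) h
      simpa using h'.symm
  rw [← hβeq, hβ]

/-- **`−1 ∈ Ẑ^×` acts on `O^×(G) = (𝒪_k̄^⊳)ˣ` by inversion**: `zhatPowOunits C (−1) = (x ↦ x⁻¹)`.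
[claim: Mochizuki2012, status: disputed] (IUTchII §1 Rmk 1.11.1 (i), kurims p.50) -/
theorem zhatPowOunits_negOneAut : zhatPowOunits C ZHatLevel.negOneAut = MulEquiv.inv ((nonzeroIntegers C.k C.K)ˣ) := by
  apply MulEquiv.ext
  intro z
  apply Units.ext
  apply Subtype.ext
  rw [coe_zhatPowOunits, coe_zhatUnitAut_negOneAut, ModelMLFGaloisData.coe_unitsEquivUnitSubmonoid, MulEquiv.inv_apply,
    coe_inv_nonzeroIntegersUnits]

/-- NON-DEGENERACY: the natural `Ẑ^×`-action on `O^×(G) = (𝒪_k̄^⊳)ˣ` is not trivial — `−1` moves a primitive cube root of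
unity `ζ₃ ∈ 𝒪_k̄^×` (`ζ₃⁻¹ ≠ ζ₃`; abc-iut-L6-d1's `MLFClosure.exists_isPrimitiveRoot`).
[claim: Mochizuki2012, status: disputed] (IUTchII §1 Rmk 1.11.1 (i), kurims p.50) -/
theorem zhatPowOunits_negOneAut_ne_one : zhatPowOunits C ZHatLevel.negOneAut ≠ 1 := by
  intro h
  obtain ⟨ζ, hζ⟩ := C.exists_isPrimitiveRoot 3 (by norm_num)
  have hζ3 : ζ ^ 3 = 1 := hζ.pow_eq_one
  have hζ0 : ζ ≠ 0 := hζ.ne_zero (by norm_num)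
  -- `ζ` as a unit of `𝒪_k̄^⊳`
  let x : unitSubmonoid C.k C.K := ⟨ζ, C.rootOfUnity_mem_unitSubmonoid (by norm_num) hζ3⟩
  let z : (nonzeroIntegers C.k C.K)ˣ := (ModelMLFGaloisData.unitsEquivUnitSubmonoid C).symm x
  have hz : (((z : (nonzeroIntegers C.k C.K)ˣ) : nonzeroIntegers C.k C.K) : C.K) = ζ := by
    rw [← ModelMLFGaloisData.coe_unitsEquivUnitSubmonoid C z]
    change (((ModelMLFGaloisData.unitsEquivUnitSubmonoid C)
      ((ModelMLFGaloisData.unitsEquivUnitSubmonoid C).symm x) : unitSubmonoid C.k C.K) : C.K) = ζ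
    rw [MulEquiv.apply_symm_apply]
  have h1 := MulEquiv.congr_fun h z
  rw [zhatPowOunits_negOneAut, MulEquiv.inv_apply, MulAut.one_apply] at h1
  -- `ζ⁻¹ = ζ`, i.e. `ζ ^ 2 = 1`, contradicting primitivity of order `3`
  have h2 := congrArg (fun w : (nonzeroIntegers C.k C.K)ˣ => ((w : nonzeroIntegers C.k C.K) : C.K)) h1
  simp only [coe_inv_nonzeroIntegersUnits, hz] at h2
  have h3 : ζ ^ 2 = 1 :=
    calc ζ ^ 2 = ζ⁻¹ * ζ := by rw [h2, pow_two]
      _ = 1 := inv_mul_cancel₀ hζ0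
  exact absurd (hζ.pow_eq_one_iff_dvd 2 |>.mp h3) (by norm_num)

end Genuine

end AbsTopMonoids

end Literature.IUT.HodgeArakelov

end
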